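import Summits.QuantumFields.BalabanUV.Beta.FP.StationarityJLimit
import Summits.QuantumFields.BalabanUV.Beta.GAN24.CombesThomas

/-!
# `BalabanUV.Beta.FP.StationarityJConvC` — road «FP» for binder row D1, leaf N1-J (limit half), CONSUMER-SIDE BRIDGE: the transport hypotheses
# (hg, hRb, hR) of `StationarityJLimit.SPerfOf_SDec_succ` ARE the field–multiplier block of row G-an2-4's (CONV-C) K-slot in the adopted units —
# `respStep (Lc^j) (Lc^(j+1)) μ z l″ w′ = KStepUnit Lc j w′ (Lc•z) (inl l″) (inr μ)` — hence no new debt: `UnitDecayK` gives (hRb)+(hg),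
# `CauchyDecayK` gives (hR) with `ρ∞ :=` the fm entries of road A2's constructed one-step limit `limMKerOf (KStepUnit Lc)`

HONEST FRAMING (cell contract, verbatim): «discharging `BetaPertH` makes Bałaban's UV stability UNCONDITIONAL — a real constructive-QFT
result; it is NOT the continuum limit and NOT the Clay problem.»  THIS MODULE DISCHARGES NOTHING of the wall: it REWRITES three hypotheses of
leaf-08's `SPerfOf_SDec_succ` (p209549) as instances of the two K-slot binder SHAPES `GAN24.CombesThomas.UnitDecayK` / `CauchyDecayK` (= asym1's
`hK` / `hKall` in the adopted units `(Lc^j, Lc^{j(d+1)})`, gan24-p1), which remain HYPOTHESES (row G-an2-4).  Composition BY NAME of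
`BalabanCompositeJets.respStep_eq` (an2), `HessKerDressedLimit.tendsto_limMKerOf_of_decays` (asym1), `B12Sec2to5.summable_exp_neg_l1`.
Claim table `HOME/b2b-balaban-beta-d1-p3/LEAVES-FP.md` row N1-J, sub-row N1-J-convC (unit `b2b-balaban-beta-d1-formalise-leaf-06`); XREAD record
GAPS § C-d1leaf06-4.  «not in print; our bookkeeping».  NOT BetaPertH, NOT continuum, NOT Clay.
HONEST DEPENDENCY (verbatim): «continuum YM on T⁴ ⇐ BetaPertH ∧ nine spine estimates (0/9 proved); BetaPertH ⇐ (D1) ∧ (D4) ∧ CAP+tail;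
G-an2-4 gates asym, D1 and NE2/3/4.»
ABSOLUTE RULE (cell, verbatim): «No internally-minted statement may enter as a cited fact. Every hypothesis is either kernel-proved in this
package or a verbatim quotation of a PUBLISHED theorem with page reference.»  Nothing is cited; no `def`; no binder instantiated at a value.

CONTENT ([folklore] / [our object]; general `d`).
* §1 `respStep_eq_KStepUnit` — the one-step minimiser response (K1b′ weight) IS the `(inl, inr)` entry of `D_j · KInvStep Lc j · D_j` (`sf·sm = (Lc^j)^{d+2}`).
* §2 `summable_exp_neg_l1_sub` (the shifted exponential majorant is summable), `abs_respStep_le_of_unitDecayK` ((hRb) with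
  `g μ z l″ w′ := C·e^{−δ|w′ − Lc•z|₁}`), `tendsto_respStep_of_cauchyDecayK` ((hR) with `ρ∞ μ z l″ w′ := limMKerOf (KStepUnit Lc) w′ (Lc•z) (inl l″) (inr μ)`).
* §3 **`SPerfOf_SDec_succ_of_KSlot`** — leaf-08's N1-J∞ with (hg, hRb, hR) replaced by `UnitDecayK ∧ CauchyDecayK` (adopted units, `0 < δ`, `θ < 1`);
  only (hUb, hU) — the stencil family's own entrywise convergence (X1m-S) — remain road-FP-side.
-/

namespace Summit.QuantumFields.BalabanUV.Beta.FP.StationarityJConvC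

open Filter Topology Finset
open scoped BigOperators
open Literature.MathematicalPhysics.QuantumFieldTheory.Balaban1983to89
open Literature.MathematicalPhysics.QuantumFieldTheory.Balaban1983to89.Beta
open B12Sec2to5 (l1 summable_exp_neg_l1)
open ExpKernelCalculus (MKer)
open OneStepResolventKernel (Fib)
open OneStepKernelFamily (dec KInvStep)
open InterLevelTransport (transportV)
open BalabanCompositeJets (Sc respStep respStep_eq)
open HessKerDressedLimit (limMKerOf tendsto_limMKerOf_of_decays)
open Summit.QuantumFields.BalabanUV.Beta.HessKerDressedUnits (unitK unitS counitK unitK_apply legScale_inl legScale_inr)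
open Summit.QuantumFields.BalabanUV.Beta.GAN24.CombesThomas (sfStep smStep KStepUnit UnitDecayK CauchyDecayK)
open Summit.QuantumFields.BalabanUV.Beta.FP.PerfectObjectsT (SPerfOf)
open Summit.QuantumFields.BalabanUV.Beta.FP.StationarityJ (SDec)
open Summit.QuantumFields.BalabanUV.Beta.FP.StationarityJLimit (SPerfOf_SDec_succ)

noncomputable section

variable {d : ℕ} {Lc : ℕ} [NeZero Lc]

/-! ## §1 The transport weight is the fm entry of the unit-normalised step resolvent -/

/-- [folklore] **THE N1-J TRANSPORT WEIGHT IS THE fm ENTRY OF THE WALL's (CONV-C) K-OBJECT IN THE ADOPTED UNITS**: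
`respStep (Lc^j) (Lc^(j+1)) μ z l″ w′ = KStepUnit Lc j w′ (Lc•z) (inl l″) (inr μ)` — `(Lc^j)^{d+2} = Lc^j · Lc^{j(d+1)} = s_f(j)·s_m(j)`. -/
theorem respStep_eq_KStepUnit (j : ℕ) (μ : Fin (d + 1)) (z : Fin (d + 1) → ℤ) (l'' : Fin (d + 1)) (w' : Fin (d + 1) → ℤ) :
    respStep (d := d) (Lc ^ j) (Lc ^ (j + 1)) μ z l'' w' =
      KStepUnit (d := d) Lc j w' (((Lc : ℕ) : ℤ) • z) (Sum.inl l'') (Sum.inr μ) := by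
  rw [respStep_eq, KStepUnit, unitK_apply, legScale_inl, legScale_inr, sfStep, smStep]
  push_cast
  ring

/-! ## §2 (hRb), (hg), (hR) from the two K-slot binder shapes -/

/-- [folklore] The shifted exponential majorant `w′ ↦ C·e^{−δ|w′ − c|₁}` is summable on `ℤ^{d+1}` (`δ > 0`). -/
theorem summable_exp_neg_l1_sub {δ : ℝ} (hδ : 0 < δ) (C : ℝ) (c : Fin (d + 1) → ℤ) :
    Summable fun w' : Fin (d + 1) → ℤ => C * Real.exp (-δ * l1 (w' - c)) := by
  have h := ((summable_exp_neg_l1 hδ (d + 1)).mul_left C).comp_injective (Equiv.subRight c).injective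
  exact h.congr fun w' => by simp [Equiv.subRight]

/-- [our object] **(hRb) FROM `UnitDecayK`** (asym1's `hK` shape, adopted units): `|respStep (Lc^j) (Lc^(j+1)) μ z l″ w′| ≤ C·e^{−δ|w′ − Lc•z|₁}`. -/
theorem abs_respStep_le_of_unitDecayK {C δ : ℝ} (hK : UnitDecayK d Lc (sfStep Lc) (smStep d Lc) C δ)
    (j : ℕ) (μ : Fin (d + 1)) (z : Fin (d + 1) → ℤ) (l'' : Fin (d + 1)) (w' : Fin (d + 1) → ℤ) :
    |respStep (d := d) (Lc ^ j) (Lc ^ (j + 1)) μ z l'' w'| ≤ C * Real.exp (-δ * l1 (w' - ((Lc : ℕ) : ℤ) • z)) := by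
  rw [respStep_eq_KStepUnit]
  exact hK j _ _ _ _

/-- [our object] **(hR) FROM `CauchyDecayK`** (asym1's `hKall` shape, adopted units, `θ < 1`): the transport weights converge, entry by entry,
to the fm entries of road A2's constructed one-step limit `limMKerOf (KStepUnit Lc)`. -/
theorem tendsto_respStep_of_cauchyDecayK {cK θ δ : ℝ} (hKall : CauchyDecayK d Lc (sfStep Lc) (smStep d Lc) cK θ δ) (hθ1 : θ < 1)
    (μ : Fin (d + 1)) (z : Fin (d + 1) → ℤ) (l'' : Fin (d + 1)) (w' : Fin (d + 1) → ℤ) :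
    Tendsto (fun j => respStep (d := d) (Lc ^ j) (Lc ^ (j + 1)) μ z l'' w') atTop
      (𝓝 (limMKerOf (KStepUnit (d := d) Lc) w' (((Lc : ℕ) : ℤ) • z) (Sum.inl l'') (Sum.inr μ))) := by
  simp only [respStep_eq_KStepUnit]
  exact tendsto_limMKerOf_of_decays (K := KStepUnit (d := d) Lc) hKall hθ1 _ _ _ _

/-! ## §3 N1-J at the limit with the transport side supplied by the K-slot -/

/-- **N1-J AT THE LIMIT, TRANSPORT SIDE FROM ROW G-an2-4's K-SLOT.**  Geometric units `(sf, sm)` with ratios `(rf, rm)`; the K-slot binders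
`UnitDecayK d Lc (sfStep Lc) (smStep d Lc) C δ` (`0 < δ`) and `CauchyDecayK d Lc (sfStep Lc) (smStep d Lc) cK θ δ` (`θ < 1`) — HYPOTHESES, row G-an2-4 —
+ (hUb, hU) on the unit-rescaled (j, m+1) stencil family ⊢ leaf-08's nesting identity with the LIMIT response
`ρ∞ μ z l″ w′ := limMKerOf (KStepUnit Lc) w′ (Lc•z) (inl l″) (inr μ)`.  Discharges nothing by itself. [our object] -/
theorem SPerfOf_SDec_succ_of_KSlot (hLc : 1 ≤ Lc) (cE cVH cΛ : ℝ) {sf sm : ℕ → ℝ} {rf rm : ℝ}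
    (hf : ∀ j, sf (j + 1) = rf * sf j) (hm : ∀ j, sm (j + 1) = rm * sm j)
    {C δ cK θ : ℝ} (hδ : 0 < δ) (hK : UnitDecayK d Lc (sfStep Lc) (smStep d Lc) C δ)
    (hKall : CauchyDecayK d Lc (sfStep Lc) (smStep d Lc) cK θ δ) (hθ1 : θ < 1) (m : ℕ) {B : ℝ}
    (hUb : ∀ j κ' u' x w a b, |unitS (sf j) (sm j) (SDec d Lc cE cVH cΛ j (m + 1)) κ' u' x w a b| ≤ B)
    (hU : ∀ κ' u' x w a b, ∃ L : ℝ, Tendsto (fun j => unitS (sf j) (sm j) (SDec d Lc cE cVH cΛ j (m + 1)) κ' u' x w a b) atTop (𝓝 L))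
    (κ : Fin (d + 1)) (u : Fin (d + 1) → ℤ) :
    SPerfOf sf sm (SDec d Lc cE cVH cΛ) m κ u =
      (((Lc : ℝ) ^ (d + 2)) * (rf * rm)⁻¹) • transportV 1
        (fun μ z l'' w' => limMKerOf (KStepUnit (d := d) Lc) w' (((Lc : ℕ) : ℤ) • z) (Sum.inl l'') (Sum.inr μ))
        (fun κ' u' => counitK rf rm (dec Lc (SPerfOf sf sm (SDec d Lc cE cVH cΛ) (m + 1) κ' u'))) κ u :=
  SPerfOf_SDec_succ hLc cE cVH cΛ hf hm
    (g := fun _ z _ w' => C * Real.exp (-δ * l1 (w' - ((Lc : ℕ) : ℤ) • z)))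
    (fun _ z _ => summable_exp_neg_l1_sub hδ C (((Lc : ℕ) : ℤ) • z))
    (fun j μ z μ' y' => abs_respStep_le_of_unitDecayK hK j μ z μ' y')
    (fun μ z μ' y' => tendsto_respStep_of_cauchyDecayK hKall hθ1 μ z μ' y') m hUb hU κ u

end

end Summit.QuantumFields.BalabanUV.Beta.FP.StationarityJConvC
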